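import Mathlib
import HarnessLib
import Summits.HubbardSuperconductivity.HubbardSuperconductivity.Theorems.KLProgrammeKLRegimeEngineV8Defs
import Summits.HubbardSuperconductivity.HubbardSuperconductivity.Theorems.KLProgrammeKLRegimeSplitLegStaging

/-!
# Route `KLProgramme` — crux K3, ENGINE child (stmt-HubbardSuperconductivity-19662 / its gen-3 successor): the `U`-SMALLNESS of the one-slice
# pair-ladder resummation AT THE NAMED ENGINE PACKAGE — `klEngGeo.bhi·(2|U| + D·U²) ≤ 1/3` for `0 ≤ U ≤ klEngU₀ P R c`,
# `D = P.C_W + klLegKappa·(klEngQ P R).CR·P.Klam³`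

Cell gate-hubbard-kl, seat hubbard-kl-k3c1-p1 (g2).  The three (E2)-family clause constructors of this seat (p461056 `pairLadderStepAtV7_of_ladderSums`,
p463012 `pairLadderStepAtV7_of_expansion`, and k3c1-p2's `klEngine_resummation_exists`) carry ONE hypothesis about the coupling: the slice bubble mass
`G.bhi` times the global entry bound `2|U| + D·U²` of the truncated pair array is at most `1/3` (so that the one-slice ladder is a convergent Neumann
series for the true complex weights as well as for the model weights).  Inside `stub_engine_step_values` the constants are the engine package of
`…EngineV8Defs` (k3c2-p1 p458215, p1 g6's profiles): `G = klEngGeo` (`bhi = 4`), `Q = klEngQ P R` (`CR = 2^{20}(Klam²+1)(cr²+cz²+1)`), and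
`U ≤ klEngU₀ P R c = 2^{-40}/((Klam²+C_W²+Cd²+1)²(cr²+cz²+1)²(c²+1))`.  This file discharges the hypothesis there, once:
`klEng_pairTolerance_le` (`D ≤ 2^{33}·A³·B`, `A = Klam²+C_W²+Cd²+1`, `B = cr²+cz²+1`), `klEngU₀_mul_denominator` / `klEngU₀_le_two_pow`
(`U₀ ≤ 2^{-40}`), **`klEng_pair_smallness`** (`P.WF → 0 ≤ U → U ≤ klEngU₀ P R c → klEngGeo.bhi·(2|U| + D·U²) ≤ 1/3`, in fact `≤ 2^{-36}`), and the sign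
`klEng_pairTolerance_nonneg` (`0 ≤ D`).  Arithmetic only; nothing about the model is asserted.  0 kit.
-/

noncomputable section

namespace Summit.HubbardSuperconductivity.HubbardSuperconductivity.Theorems.EngineV8

set_option linter.dupNamespace false -- summit = problem name (single-conjunct summit), D-0017

open Real Finset
open Summit.HubbardSuperconductivity.HubbardSuperconductivity.Theorems.KLRegimeSplit

/-- The `Q`-aware pair-array tolerance constant at the package is nonnegative: `0 ≤ P.C_W + klLegKappa·(klEngQ P R).CR·P.Klam³` (`P.WF`). -/
theorem klEng_pairTolerance_nonneg {P : SplitConsts} (hP : P.WF) (R : RenConsts) :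
    0 ≤ P.C_W + klLegKappa * (klEngQ P R).CR * P.Klam ^ 3 := by
  obtain ⟨hK, hCW, -⟩ := hP
  have hCR : 0 ≤ (klEngQ P R).CR := (klEngQ_wf P R).2.1
  have hK0 : 0 ≤ P.Klam := zero_le_one.trans hK
  unfold klLegKappa
  positivity

/-- **The tolerance constant against the package's polynomial sizes**: with `A = Klam² + C_W² + Cd² + 1` and `B = cr² + cz² + 1`,
`P.C_W + klLegKappa·(klEngQ P R).CR·P.Klam³ ≤ 2^{33}·A³·B` (`P.WF` for `Klam ≥ 1`). -/
theorem klEng_pairTolerance_le {P : SplitConsts} (hP : P.WF) (R : RenConsts) :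
    P.C_W + klLegKappa * (klEngQ P R).CR * P.Klam ^ 3 ≤
      (2 : ℝ) ^ 33 * (P.Klam ^ 2 + P.C_W ^ 2 + P.Cd ^ 2 + 1) ^ 3 * (R.cr ^ 2 + R.cz ^ 2 + 1) := by
  obtain ⟨hK, hCW, hCd⟩ := hP
  set A : ℝ := P.Klam ^ 2 + P.C_W ^ 2 + P.Cd ^ 2 + 1 with hA_def
  set B : ℝ := R.cr ^ 2 + R.cz ^ 2 + 1 with hB_def
  have hA1 : 1 ≤ A := by rw [hA_def]; nlinarith [sq_nonneg P.Klam, sq_nonneg P.C_W, sq_nonneg P.Cd]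
  have hB1 : 1 ≤ B := by rw [hB_def]; nlinarith [sq_nonneg R.cr, sq_nonneg R.cz]
  have hA0 : 0 ≤ A := zero_le_one.trans hA1
  have hB0 : 0 ≤ B := zero_le_one.trans hB1
  have hK0 : 0 ≤ P.Klam := zero_le_one.trans hK
  -- `C_W ≤ A`, `Klam² + 1 ≤ A`, `Klam³ ≤ A²`
  have hCWA : P.C_W ≤ A := by rw [hA_def]; nlinarith [sq_nonneg (P.C_W - 1), sq_nonneg P.Klam, sq_nonneg P.Cd]
  have hK2A : P.Klam ^ 2 + 1 ≤ A := by rw [hA_def]; nlinarith [sq_nonneg P.C_W, sq_nonneg P.Cd]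
  have hK2A' : P.Klam ^ 2 ≤ A := by linarith
  have hK3 : P.Klam ^ 3 ≤ A ^ 2 := by
    calc P.Klam ^ 3 = P.Klam ^ 2 * P.Klam := by ring
      _ ≤ P.Klam ^ 2 * P.Klam ^ 2 := by
          apply mul_le_mul_of_nonneg_left _ (sq_nonneg _)
          nlinarith
      _ = (P.Klam ^ 2) ^ 2 := by ring
      _ ≤ A ^ 2 := pow_le_pow_left₀ (sq_nonneg _) hK2A' 2
  have hCR : (klEngQ P R).CR = 2 ^ 20 * (P.Klam ^ 2 + 1) * B := rfl
  rw [hCR]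
  unfold klLegKappa
  -- the cubic term
  have h1 : (4000 : ℝ) * (2 ^ 20 * (P.Klam ^ 2 + 1) * B) * P.Klam ^ 3 ≤ 2 ^ 32 * A ^ 3 * B := by
    have h4000 : (4000 : ℝ) ≤ 2 ^ 12 := by norm_num
    have hK21 : 0 ≤ P.Klam ^ 2 + 1 := by positivity
    calc (4000 : ℝ) * (2 ^ 20 * (P.Klam ^ 2 + 1) * B) * P.Klam ^ 3
        = 4000 * 2 ^ 20 * ((P.Klam ^ 2 + 1) * B * P.Klam ^ 3) := by ring
      _ ≤ 2 ^ 12 * 2 ^ 20 * (A * B * A ^ 2) := by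
          apply mul_le_mul (by nlinarith) _ (by positivity) (by positivity)
          exact mul_le_mul (mul_le_mul_of_nonneg_right hK2A hB0) hK3 (pow_nonneg hK0 3) (mul_nonneg hA0 hB0)
      _ = 2 ^ 32 * A ^ 3 * B := by ring
  -- the constant term
  have h2 : P.C_W ≤ 2 ^ 32 * A ^ 3 * B := by
    have : A ≤ A ^ 3 * B := by
      calc A = A * 1 * 1 := by ring
        _ ≤ A * A ^ 2 * B := by
            apply mul_le_mul (mul_le_mul_of_nonneg_left (by nlinarith) hA0) hB1 zero_le_one (by positivity)
        _ = A ^ 3 * B := by ring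
    nlinarith
  linarith

/-- `klEngU₀ P R c` times its denominator is `1`. -/
theorem klEngU₀_mul_denominator (P : SplitConsts) (R : RenConsts) (c : ℝ) :
    klEngU₀ P R c * ((2 : ℝ) ^ 40 * (P.Klam ^ 2 + P.C_W ^ 2 + P.Cd ^ 2 + 1) ^ 2 * (R.cr ^ 2 + R.cz ^ 2 + 1) ^ 2 * (c ^ 2 + 1)) = 1 := by
  unfold klEngU₀
  have : 0 < (2 : ℝ) ^ 40 * (P.Klam ^ 2 + P.C_W ^ 2 + P.Cd ^ 2 + 1) ^ 2 * (R.cr ^ 2 + R.cz ^ 2 + 1) ^ 2 * (c ^ 2 + 1) := by positivity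
  field_simp

/-- `klEngU₀ P R c ≤ 2^{-40}`. -/
theorem klEngU₀_le_two_pow (P : SplitConsts) (R : RenConsts) (c : ℝ) : klEngU₀ P R c ≤ ((2 : ℝ) ^ 40)⁻¹ := by
  unfold klEngU₀
  rw [one_div]
  apply inv_anti₀ (by positivity)
  have hA1 : 1 ≤ (P.Klam ^ 2 + P.C_W ^ 2 + P.Cd ^ 2 + 1) ^ 2 := one_le_pow₀ (by nlinarith [sq_nonneg P.Klam, sq_nonneg P.C_W, sq_nonneg P.Cd])
  have hB1 : 1 ≤ (R.cr ^ 2 + R.cz ^ 2 + 1) ^ 2 := one_le_pow₀ (by nlinarith [sq_nonneg R.cr, sq_nonneg R.cz])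
  have hC1 : 1 ≤ c ^ 2 + 1 := by nlinarith [sq_nonneg c]
  calc (2 : ℝ) ^ 40 = 2 ^ 40 * 1 * 1 * 1 := by ring
    _ ≤ 2 ^ 40 * (P.Klam ^ 2 + P.C_W ^ 2 + P.Cd ^ 2 + 1) ^ 2 * (R.cr ^ 2 + R.cz ^ 2 + 1) ^ 2 * (c ^ 2 + 1) := by
        gcongr

/-- **The `U`-smallness of the one-slice pair-ladder resummation at the engine package.**  For `P.WF`, `0 ≤ U ≤ klEngU₀ P R c`:
`klEngGeo.bhi·(2|U| + (P.C_W + klLegKappa·(klEngQ P R).CR·P.Klam³)·U²) ≤ 1/3` — the `hsmall` hypothesis of `pairLadderStepAtV7_of_ladderSums` /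
`pairLadderStepAtV7_of_expansion` / `klpli_pair_witness` at `G = klEngGeo`, `Q = klEngQ P R` (and, a fortiori, k3c1-p2's `(Σ w)·D·U² ≤ 1/3` for
`Σ w ≤ bhi`). -/
theorem klEng_pair_smallness {P : SplitConsts} (hP : P.WF) (R : RenConsts) (c : ℝ) {U : ℝ} (hU0 : 0 ≤ U) (hU : U ≤ klEngU₀ P R c) :
    klEngGeo.bhi * (2 * |U| + (P.C_W + klLegKappa * (klEngQ P R).CR * P.Klam ^ 3) * U ^ 2) ≤ 1 / 3 := by
  have hbhi : klEngGeo.bhi = 4 := rfl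
  rw [hbhi, abs_of_nonneg hU0]
  -- abbreviations (plain reals, no `set`)
  obtain ⟨A, hA_def⟩ : ∃ A : ℝ, A = P.Klam ^ 2 + P.C_W ^ 2 + P.Cd ^ 2 + 1 := ⟨_, rfl⟩
  obtain ⟨B, hB_def⟩ : ∃ B : ℝ, B = R.cr ^ 2 + R.cz ^ 2 + 1 := ⟨_, rfl⟩
  obtain ⟨Cc, hCc_def⟩ : ∃ Cc : ℝ, Cc = c ^ 2 + 1 := ⟨_, rfl⟩
  have hA1 : 1 ≤ A := by rw [hA_def]; nlinarith [sq_nonneg P.Klam, sq_nonneg P.C_W, sq_nonneg P.Cd]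
  have hB1 : 1 ≤ B := by rw [hB_def]; nlinarith [sq_nonneg R.cr, sq_nonneg R.cz]
  have hC1 : 1 ≤ Cc := by rw [hCc_def]; nlinarith [sq_nonneg c]
  have hA0 : 0 ≤ A := zero_le_one.trans hA1
  have hB0 : 0 ≤ B := zero_le_one.trans hB1
  have hC0 : 0 ≤ Cc := zero_le_one.trans hC1
  obtain ⟨X, hX_def⟩ : ∃ X : ℝ, X = (2 : ℝ) ^ 40 * A ^ 2 * B ^ 2 * Cc := ⟨_, rfl⟩
  have hX40 : (2 : ℝ) ^ 40 ≤ X := by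
    rw [hX_def]
    have h1 : 1 ≤ A ^ 2 := one_le_pow₀ hA1
    have h2 : 1 ≤ B ^ 2 := one_le_pow₀ hB1
    calc (2 : ℝ) ^ 40 = 2 ^ 40 * 1 * 1 * 1 := by ring
      _ ≤ 2 ^ 40 * A ^ 2 * B ^ 2 * Cc := by gcongr
  have hX : 0 < X := lt_of_lt_of_le (by positivity) hX40
  have hU₀X : klEngU₀ P R c * X = 1 := by
    rw [hX_def, hA_def, hB_def, hCc_def]; exact klEngU₀_mul_denominator P R c
  have hU₀ : klEngU₀ P R c = X⁻¹ := eq_inv_of_mul_eq_one_left hU₀X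
  -- the tolerance constant against `X²`
  have hDX : P.C_W + klLegKappa * (klEngQ P R).CR * P.Klam ^ 3 ≤ ((2 : ℝ) ^ 47)⁻¹ * X ^ 2 := by
    refine (klEng_pairTolerance_le hP R).trans ?_
    rw [← hA_def, ← hB_def]
    have h1 : A ^ 3 * B ≤ A ^ 4 * B ^ 4 * Cc ^ 2 := by
      have hAB : 1 ≤ A * B ^ 3 := by
        calc (1 : ℝ) = 1 * 1 := by ring
          _ ≤ A * B ^ 3 := mul_le_mul hA1 (one_le_pow₀ hB1) zero_le_one hA0
      have hC2 : 1 ≤ Cc ^ 2 := one_le_pow₀ hC1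
      calc A ^ 3 * B = A ^ 3 * B * 1 * 1 := by ring
        _ ≤ A ^ 3 * B * (A * B ^ 3) * Cc ^ 2 := by gcongr
        _ = A ^ 4 * B ^ 4 * Cc ^ 2 := by ring
    calc (2 : ℝ) ^ 33 * A ^ 3 * B = 2 ^ 33 * (A ^ 3 * B) := by ring
      _ ≤ 2 ^ 33 * (A ^ 4 * B ^ 4 * Cc ^ 2) := by gcongr
      _ = ((2 : ℝ) ^ 47)⁻¹ * X ^ 2 := by rw [hX_def]; ring
  -- `U ≤ X⁻¹ ≤ 2^{-40}` and `D·U² ≤ 2^{-47}`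
  have hUX : U ≤ X⁻¹ := by
    calc U ≤ klEngU₀ P R c := hU
      _ = X⁻¹ := hU₀
  have hU40 : U ≤ ((2 : ℝ) ^ 40)⁻¹ := hUX.trans (inv_anti₀ (by positivity) hX40)
  have hU2 : U ^ 2 ≤ (X⁻¹) ^ 2 := pow_le_pow_left₀ hU0 hUX 2
  have hD0 : 0 ≤ P.C_W + klLegKappa * (klEngQ P R).CR * P.Klam ^ 3 := klEng_pairTolerance_nonneg hP R
  have hDU : (P.C_W + klLegKappa * (klEngQ P R).CR * P.Klam ^ 3) * U ^ 2 ≤ ((2 : ℝ) ^ 47)⁻¹ := by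
    have hXX : X ^ 2 * (X⁻¹) ^ 2 = 1 := by rw [inv_pow, mul_inv_cancel₀ (pow_ne_zero 2 hX.ne')]
    calc (P.C_W + klLegKappa * (klEngQ P R).CR * P.Klam ^ 3) * U ^ 2
        ≤ (((2 : ℝ) ^ 47)⁻¹ * X ^ 2) * (X⁻¹) ^ 2 := mul_le_mul hDX hU2 (sq_nonneg U) (by positivity)
      _ = ((2 : ℝ) ^ 47)⁻¹ * (X ^ 2 * (X⁻¹) ^ 2) := by ring
      _ = ((2 : ℝ) ^ 47)⁻¹ := by rw [hXX, mul_one]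
  have h40 : ((2 : ℝ) ^ 40)⁻¹ ≤ 1 / 100 := by norm_num
  have h47 : ((2 : ℝ) ^ 47)⁻¹ ≤ 1 / 100 := by norm_num
  linarith

end Summit.HubbardSuperconductivity.HubbardSuperconductivity.Theorems.EngineV8

end
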